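import Literature.AlgebraicGeometry.ShimuraVarieties.UnitaryCurveAuxiliaryIntegralActionV
import Literature.AlgebraicGeometry.ModuliOfAbelianVarieties.SiegelIntegralReadingConjugation
import HarnessLib

/-!
# The `𝒪`-action read AT THE CHART: the (M) fields `Mρ`, `Mρ_rosati` and the Kottwitz bridge of the E-line chart from the frame reading and the movers

Topic `AlgebraicGeometry/ShimuraVarieties`; namespace `Literature.AlgebraicGeometry.ShimuraVarieties.UnitaryCurve.AuxV`.
Theorems only (no definition, no named fact, no instance).  Cell `hodgecm-mathlib` (D-0151), FLOOR 0, P6 «MOD programme», door (E) of `stub_RGD`,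
organ **E1 FILE 9 (junction)** (A-p01 (g26), 2026-09-01): ONE theorem composing ★ E1 FILE 7b (`UnitaryCurveAuxiliaryIntegralActionV`: the frame reading
`ρ : 𝓞 M →+* M_{2g}(ℤ)`, its Rosati identity, `(ρ b)_R = auxRepV R β (1⊗b, 1)` and its commutation with the carrier), ★ E1 FILE 8
(`SiegelIntegralReadingConjugation`: transport along a mover) and ★ E2 FILE C (`periodZV`, `siegelOfJ ∘ jOfSiegel = id`) at the outputs of ★ E3 FILE D
(`UnitaryCurveSiegelChartMover`: movers `q_a` with (Q1) `conjJ (q_a)_ℝ⁻¹ (J_Φ v) = jOfSiegel δ (Z a v)` and (Q2) `(q_a)_f • rep K_δ(N) = b(a) K_δ(N)`), delivering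
the (M) fields of `AuxChartGS` (`Cruxes/HLiu418/Lines/F0_P6a_PELWitnessE.lean`) in their token shapes:
`Mρ a : 𝓞 M →+* M_{2g}(ℤ)` with `Mρ_rosati` VERBATIM, the identity `(Mρ a b)_ℝ = conjJ γ_a N_b` (`γ_a = (q_a)_ℝ⁻¹`, `N_b = auxRepV ℝ β (1⊗b, 1)`) and
`periodZV γ_a v = Z a v`, which turn ★ E2 FILE D `exists_lieAction_charpoly (γ := γ_a)` into `Mρ_kottwitz` (the charpoly census is E2's).
`--supports stmt-HodgeConjecture-24832`, count-neutral; HC_CM is proved only modulo the printed citations until rung 0 closes.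

* `exists_chartActionReading` — THE JUNCTION.

## References
* [Kottwitz1992] R. Kottwitz, *Points on some Shimura varieties over finite fields*, JAMS 5 (1992), §5 p. 390.
* [RapoportSmithlingZhang2020Diagonal] M. Rapoport, B. Smithling, W. Zhang (2020), §3.2 (3.8) p. 11, §4.1 p. 17.
* [Milne2005ShimuraVarieties] J. S. Milne, *Introduction to Shimura varieties* (2005), Lemma 5.13 p. 57, §6 pp. 67–70, Thm. 6.11 p. 74.
* [Deligne1979ShimuraVarieties] P. Deligne, *Variétés de Shimura* (1979), Prop. 2.3.10.
-/

set_option autoImplicit false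

noncomputable section

open Matrix NumberField IsDedekindDomain
open scoped TensorProduct
open Literature.AlgebraicGeometry.ModuliOfAbelianVarieties
open Literature.AlgebraicGeometry.ModuliOfAbelianVarieties.SiegelModuli (C0 jOfSiegel siegelOfJ siegelOfJ_jOfSiegel)
open Literature.AlgebraicGeometry.Motives (CMType)
open Literature.NumberTheory.Automorphic (siegelUpperHalfSpace)

namespace Literature.AlgebraicGeometry.ShimuraVarieties

namespace UnitaryCurve

namespace AuxV

open Literature.AlgebraicGeometry.ShimuraVarieties.UnitaryCanonicalModel.Aux (ratBasis torusFinAdelic torusToTensorFin)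
open Literature.AlgebraicGeometry.ShimuraVarieties.UnitaryCurve.Aux (unitaryToTensorFin)
open Literature.NumberTheory.Automorphic Literature.NumberTheory.Automorphic.UnitaryGroup

variable {L : Type} [Field L] [NumberField L] [IsCMField L] (M : Type) [Field M] [NumberField M] [IsCMField M] {j : L →+* M}
  {n : ℕ} {H : Matrix (Fin n) (Fin n) L} {ξ : M} {g : ℕ} {δ : Fin g → ℕ}
  (F : SymplecticFrameV M j H ξ g δ) (Φ : CMType M) (τ : L →+* ℂ)

/-- **THE (M) FIELDS OF THE AUXILIARY CHART.**  Given the frame reading `ρ` of ★ `exists_symplecticFrameV_integralAction` (property `hρ`), integral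
representatives `rep c ∈ K_δ(1)`, and per adelic representative `a` a period function `Z a` and a mover `q a ∈ GSp_δ(ℚ)` with (Q1)
`conjJ (q a)_ℝ⁻¹ (J_Φ(v)) = jOfSiegel δ (Z a v)` and (Q2) `(q a)_f • (rep (piece a)) K_δ(N) = (ũ_β(a, 1)) K_δ(N)` on the negative cone (★ `exists_siegelChartGS_mover`),
there is `Mρ : a ↦ (𝓞 M →+* M_{2g}(ℤ))` — the `𝒪`-action in the marking `(Z a v, rep (piece a))` — with:
(R) ROSATI `(b' : M) = b̄ → (Mρ a b')ᵀ E_δ = E_δ (Mρ a b)` (every `a`); (N) on the cone, `(Mρ a b)_ℝ = conjJ γ_a N_b`, `γ_a = (q a)_ℝ⁻¹`,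
`N_b = auxRepV ℝ β (t, 1)`, `t = 1 ⊗ b`; (Z) on the cone, `periodZV γ_a v = Z a v`.  With (N) and (Z), ★ `exists_lieAction_charpoly (γ := γ_a)` IS `Mρ_kottwitz`.
[cite: Kottwitz1992, §5 p. 390] [cite: RapoportSmithlingZhang2020Diagonal, §4.1 p. 17] [cite: Milne2005ShimuraVarieties, Thm. 6.11 p. 74] -/
theorem exists_chartActionReading (hδ : ∀ i, 0 < δ i) {N : ℕ}
    (ρ : 𝓞 M →+* Matrix (Fin g ⊕ Fin g) (Fin g ⊕ Fin g) ℤ)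
    (hρ : ∀ b : 𝓞 M, (ρ b).map (Int.cast : ℤ → ℚ) =
      framePV F * resMatrix (m := Fin n) (ratBasis M) (((b : 𝓞 M) : M) • (1 : Matrix (Fin n) (Fin n) M)) * frameQV F)
    {ι : Type} (rep : ι → ↥(gspFinAdelic δ)) (hrep : ∀ c, rep c ∈ principalLevelSubgroup δ 1)
    (piece : ↥(finAdelic (↥(maximalRealSubfield L)) L (IsCMField.complexConj L) n H) → ι)
    (Z : ↥(finAdelic (↥(maximalRealSubfield L)) L (IsCMField.complexConj L) n H) → (Fin n → ℂ) → Matrix (Fin g) (Fin g) ℂ)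
    (q : ↥(finAdelic (↥(maximalRealSubfield L)) L (IsCMField.complexConj L) n H) → ↥(gspRational δ))
    (hZ : ∀ a (v : Fin n → ℂ), v ∈ negCone (H.map τ) → Z a v ∈ siegelUpperHalfSpace g)
    (hq : ∀ (v : Fin n → ℂ), v ∈ negCone (H.map τ) → ∀ a,
      conjJ (((gspRationalToReal δ (q a))⁻¹ : ↥(gspReal δ)) : GL (Fin g ⊕ Fin g) ℝ) (auxComplexStructureV F τ Φ v) = jOfSiegel δ (Z a v) ∧
        gspRationalToFinAdelic δ (q a) • ((rep (piece a) : ↥(gspFinAdelic δ)) : ↥(gspFinAdelic δ) ⧸ principalLevelSubgroup δ N) =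
          ((auxToGspFinV F (a, 1) : ↥(gspFinAdelic δ)) : ↥(gspFinAdelic δ) ⧸ principalLevelSubgroup δ N)) :
    ∃ Mρ : ↥(finAdelic (↥(maximalRealSubfield L)) L (IsCMField.complexConj L) n H) → (𝓞 M →+* Matrix (Fin g ⊕ Fin g) (Fin g ⊕ Fin g) ℤ),
      (∀ a (b b' : 𝓞 M), ((b' : 𝓞 M) : M) = IsCMField.complexConj M ((b : 𝓞 M) : M) → (Mρ a b')ᵀ * typeForm δ = typeForm δ * Mρ a b) ∧
      (∀ (v : Fin n → ℂ), v ∈ negCone (H.map τ) → ∀ a (b : 𝓞 M) (t : (ℝ ⊗[ℚ] M)ˣ), (t : ℝ ⊗[ℚ] M) = (1 : ℝ) ⊗ₜ[ℚ] ((b : 𝓞 M) : M) →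
        (Mρ a b).map (Int.cast : ℤ → ℝ) =
          conjJ (((gspRationalToReal δ (q a))⁻¹ : ↥(gspReal δ)) : GL (Fin g ⊕ Fin g) ℝ)
            ((auxRepV ℝ F (t, 1) : GL (Fin g ⊕ Fin g) ℝ) : Matrix (Fin g ⊕ Fin g) (Fin g ⊕ Fin g) ℝ)) ∧
      (∀ (v : Fin n → ℂ), v ∈ negCone (H.map τ) → ∀ a,
        periodZV M F Φ τ (((gspRationalToReal δ (q a))⁻¹ : ↥(gspReal δ)) : GL (Fin g ⊕ Fin g) ℝ) v = Z a v) := by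
  classical
  -- (Z) is independent of the construction
  have hZeq : ∀ (v : Fin n → ℂ), v ∈ negCone (H.map τ) → ∀ a,
      periodZV M F Φ τ (((gspRationalToReal δ (q a))⁻¹ : ↥(gspReal δ)) : GL (Fin g ⊕ Fin g) ℝ) v = Z a v := by
    intro v hv a
    rw [periodZV, (hq v hv a).1, siegelOfJ_jOfSiegel hδ (hZ a v hv)]
  -- the commutation of the reading with the adelic point `ũ_β(a, 1)`
  have hcomm : ∀ a (b : 𝓞 M),
      (ρ b).map (Int.cast : ℤ → finAdeleQ) *
          (((auxToGspFinV F (a, 1) : ↥(gspFinAdelic δ)) : GL (Fin g ⊕ Fin g) finAdeleQ) : Matrix (Fin g ⊕ Fin g) (Fin g ⊕ Fin g) finAdeleQ) =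
        (((auxToGspFinV F (a, 1) : ↥(gspFinAdelic δ)) : GL (Fin g ⊕ Fin g) finAdeleQ) : Matrix (Fin g ⊕ Fin g) (Fin g ⊕ Fin g) finAdeleQ) *
          (ρ b).map (Int.cast : ℤ → finAdeleQ) := by
    intro a b
    rw [coe_auxToGspFinV]
    exact map_intCast_reading_mul_coe_auxRepV_comm F ρ hρ finAdeleQ b _
  by_cases hne : (negCone (H.map τ)).Nonempty
  swap
  · -- empty cone: the unconjugated reading does it (only Rosati is asked)
    refine ⟨fun _ => ρ, fun a b b' hb' => reading_transpose_mul_typeForm F ρ hρ b b' hb', fun v hv => absurd ⟨v, hv⟩ hne,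
      fun v hv => absurd ⟨v, hv⟩ hne⟩
  obtain ⟨v₀, hv₀⟩ := hne
  -- the transported readings, one per `a`
  have hex : ∀ a, ∃ ρ' : 𝓞 M →+* Matrix (Fin g ⊕ Fin g) (Fin g ⊕ Fin g) ℤ, ∀ b, (ρ' b).map (Int.cast : ℤ → ℚ) =
      ((((q a)⁻¹ : ↥(gspRational δ)) : GL (Fin g ⊕ Fin g) ℚ) : Matrix (Fin g ⊕ Fin g) (Fin g ⊕ Fin g) ℚ) * (ρ b).map (Int.cast : ℤ → ℚ) *
        (((q a : ↥(gspRational δ)) : GL (Fin g ⊕ Fin g) ℚ) : Matrix (Fin g ⊕ Fin g) (Fin g ⊕ Fin g) ℚ) := fun a =>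
    exists_ringHom_conj_of_smul_mk_eq ρ (q a) (auxToGspFinV F (a, 1)) (rep (piece a)) (principalLevelSubgroup δ N)
      (principalLevelSubgroup_anti δ (one_dvd N)) (hrep (piece a)) (hq v₀ hv₀ a).2 (hcomm a)
  choose Mρ hMρ using hex
  refine ⟨Mρ, fun a b b' hb' => ?_, fun v hv a b t ht => ?_, hZeq⟩
  · exact conj_reading_transpose_mul_typeForm ρ (Mρ a) (q a) (hMρ a) b b' (reading_transpose_mul_typeForm F ρ hρ b b' hb')
  · rw [conj_reading_map_real ρ (Mρ a) (q a) (hMρ a) b, map_intCast_reading_eq_coe_auxRepV F ρ hρ ℝ b t ht, conjJ_def]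

open scoped Classical in
/-- **ED. 2 — ALL THREE (M) FIELDS AT ONCE, KOTTWITZ IN E2's CENSUS FORM.**  Same inputs as `exists_chartActionReading`; in addition to (R)(N)(Z) the
reading satisfies (K): for `v` on the negative cone, every `a` and every `b ∈ 𝓞 M` with `b ≠ 0`, there is a `ℂ`-linear `Cb` on `Lie = (ℂ^g, Φ_{Z a v})` with
`Cb (Φ_{Z a v} u) = Φ_{Z a v} ((Mρ a b)_ℝ u)` and E2's Lie-type census as characteristic polynomial (★ E2 FILE D `exists_lieAction_charpoly` at
`γ := (q a)_ℝ⁻¹`, transported by (N)(Z); `hC0` from (Q1) and ★ `jOfSiegel_mem_C0`).  For the CURVE (`n = 2`, `τ = ι₁`, E2 CM type `flip ι₁ (bar Φ)`) the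
census is rewritten to `∏ φ, (X − φ b)^{mOf ι₁ Φ φ}` by ★ `CMTypeOps.prod_lieCensus_flip_bar_eq_prod_pow`; `b = 0` is the zero map.
[cite: Kottwitz1992, §5 p. 390] [cite: RapoportSmithlingZhang2020Diagonal, §3.2 (3.8) p. 11, §4.1 p. 17] -/
theorem exists_chartActionReading_kottwitz (hδ : ∀ i, 0 < δ i) {N : ℕ}
    (ρ : 𝓞 M →+* Matrix (Fin g ⊕ Fin g) (Fin g ⊕ Fin g) ℤ)
    (hρ : ∀ b : 𝓞 M, (ρ b).map (Int.cast : ℤ → ℚ) =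
      framePV F * resMatrix (m := Fin n) (ratBasis M) (((b : 𝓞 M) : M) • (1 : Matrix (Fin n) (Fin n) M)) * frameQV F)
    {ι : Type} (rep : ι → ↥(gspFinAdelic δ)) (hrep : ∀ c, rep c ∈ principalLevelSubgroup δ 1)
    (piece : ↥(finAdelic (↥(maximalRealSubfield L)) L (IsCMField.complexConj L) n H) → ι)
    (Z : ↥(finAdelic (↥(maximalRealSubfield L)) L (IsCMField.complexConj L) n H) → (Fin n → ℂ) → Matrix (Fin g) (Fin g) ℂ)
    (q : ↥(finAdelic (↥(maximalRealSubfield L)) L (IsCMField.complexConj L) n H) → ↥(gspRational δ))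
    (hZ : ∀ a (v : Fin n → ℂ), v ∈ negCone (H.map τ) → Z a v ∈ siegelUpperHalfSpace g)
    (hq : ∀ (v : Fin n → ℂ), v ∈ negCone (H.map τ) → ∀ a,
      conjJ (((gspRationalToReal δ (q a))⁻¹ : ↥(gspReal δ)) : GL (Fin g ⊕ Fin g) ℝ) (auxComplexStructureV F τ Φ v) = jOfSiegel δ (Z a v) ∧
        gspRationalToFinAdelic δ (q a) • ((rep (piece a) : ↥(gspFinAdelic δ)) : ↥(gspFinAdelic δ) ⧸ principalLevelSubgroup δ N) =
          ((auxToGspFinV F (a, 1) : ↥(gspFinAdelic δ)) : ↥(gspFinAdelic δ) ⧸ principalLevelSubgroup δ N)) :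
    ∃ Mρ : ↥(finAdelic (↥(maximalRealSubfield L)) L (IsCMField.complexConj L) n H) → (𝓞 M →+* Matrix (Fin g ⊕ Fin g) (Fin g ⊕ Fin g) ℤ),
      (∀ a (b b' : 𝓞 M), ((b' : 𝓞 M) : M) = IsCMField.complexConj M ((b : 𝓞 M) : M) → (Mρ a b')ᵀ * typeForm δ = typeForm δ * Mρ a b) ∧
      (∀ (v : Fin n → ℂ), v ∈ negCone (H.map τ) → ∀ a (b : 𝓞 M) (t : (ℝ ⊗[ℚ] M)ˣ), (t : ℝ ⊗[ℚ] M) = (1 : ℝ) ⊗ₜ[ℚ] ((b : 𝓞 M) : M) →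
        (Mρ a b).map (Int.cast : ℤ → ℝ) =
          conjJ (((gspRationalToReal δ (q a))⁻¹ : ↥(gspReal δ)) : GL (Fin g ⊕ Fin g) ℝ)
            ((auxRepV ℝ F (t, 1) : GL (Fin g ⊕ Fin g) ℝ) : Matrix (Fin g ⊕ Fin g) (Fin g ⊕ Fin g) ℝ)) ∧
      (∀ (v : Fin n → ℂ), v ∈ negCone (H.map τ) → ∀ a,
        periodZV M F Φ τ (((gspRationalToReal δ (q a))⁻¹ : ↥(gspReal δ)) : GL (Fin g ⊕ Fin g) ℝ) v = Z a v) ∧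
      (∀ (v : Fin n → ℂ), v ∈ negCone (H.map τ) → ∀ a (b : 𝓞 M), ((b : 𝓞 M) : M) ≠ 0 →
        ∃ Cb : (Fin g → ℂ) →ₗ[ℂ] (Fin g → ℂ),
          (∀ u : Fin g ⊕ Fin g → ℝ,
              Cb (siegelPeriodMap δ (Z a v) u) = siegelPeriodMap δ (Z a v) (((Mρ a b).map (Int.cast : ℤ → ℝ)) *ᵥ u)) ∧
            Cb.charpoly = ∏ ρ' : Φ.1, if ρ'.1.comp j = τ then
              (Polynomial.X - Polynomial.C (ComplexEmbedding.conjugate ρ'.1 ((b : 𝓞 M) : M))) *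
                (Polynomial.X - Polynomial.C (ρ'.1 ((b : 𝓞 M) : M))) ^ (n - 1)
              else (Polynomial.X - Polynomial.C (ρ'.1 ((b : 𝓞 M) : M))) ^ n) := by
  obtain ⟨Mρ, hR, hN, hZeq⟩ := exists_chartActionReading M F Φ τ hδ ρ hρ rep hrep piece Z q hZ hq
  refine ⟨Mρ, hR, hN, hZeq, fun v hv a b hb => ?_⟩
  set γ : GL (Fin g ⊕ Fin g) ℝ := (((gspRationalToReal δ (q a))⁻¹ : ↥(gspReal δ)) : GL (Fin g ⊕ Fin g) ℝ) with hγ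
  have hC0 : conjJ γ (auxComplexStructureV F τ Φ v) ∈ C0 δ := by
    rw [hγ, (hq v hv a).1]
    exact SiegelModuli.jOfSiegel_mem_C0 hδ (hZ a v hv)
  obtain ⟨t, ht⟩ := exists_tensorUnit_coe_eq_one_tmul M ℝ ((b : 𝓞 M) : M) hb
  obtain ⟨Cb, hCb, hchar⟩ := exists_lieAction_charpoly M F Φ τ hδ γ hv hC0 t ((b : 𝓞 M) : M) ht
  refine ⟨Cb, fun u => ?_, hchar⟩
  rw [← hZeq v hv a, hN v hv a b t ht, ← hγ]
  exact hCb u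


/-! ### ED. 3 — the rational FRAME LAW (fr) exported (A-p15 (g18), 2026-09-02; E-LINE ED. 5 field (M-fr)) -/

open scoped Classical in
/-- **ED. 3 — ALL FOUR (M) LAWS (R)(N)(Z)(K) TOGETHER WITH THE RATIONAL FRAME LAW (fr).**  Same inputs as
`exists_chartActionReading_kottwitz`; the reading `Mρ` moreover satisfies, on the negative cone, the RATIONAL FRAME LAW
«`(Mρ a b)_ℚ = (q a)⁻¹ · (ρ b)_ℚ · (q a)`» — every `Mρ a` is the mover-conjugate of the ONE frame reading `ρ` (the relation `hMρ a` of the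
ED. 1 construction, ★ `exists_ringHom_conj_of_smul_mk_eq`).  This is the clause that compares `Mρ a` with `Mρ a′` ACROSS adelic
representatives — the E-LINE ED. 5 field (M-fr) `Mρ_frame` (LEAD F0P6-plan (g3), 2026-09-02 01:36:19Z), input of ★ (K-c)
`adelicCongr_mulVec_of_frame` (the `hℓ` clause of the E6-γ kernel at a special point across its reciprocity move `a′ ~ d·a`); the
per-representative laws (R)(N)(Z)(K) cannot supply it.  Guarded by `v ∈ negCone` like (N)(Z): the empty-cone branch reads `Mρ := ρ`.
[cite: Kottwitz1992, §5 p. 390] [cite: Milne2005ShimuraVarieties, Thm. 6.11 p. 74; §14 Prop. 14.12 p. 125]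
[cite: RapoportSmithlingZhang2020Diagonal, §3.2 (3.8) p. 11, §4.1 p. 17] -/
theorem exists_chartActionReading_frame (hδ : ∀ i, 0 < δ i) {N : ℕ}
    (ρ : 𝓞 M →+* Matrix (Fin g ⊕ Fin g) (Fin g ⊕ Fin g) ℤ)
    (hρ : ∀ b : 𝓞 M, (ρ b).map (Int.cast : ℤ → ℚ) =
      framePV F * resMatrix (m := Fin n) (ratBasis M) (((b : 𝓞 M) : M) • (1 : Matrix (Fin n) (Fin n) M)) * frameQV F)
    {ι : Type} (rep : ι → ↥(gspFinAdelic δ)) (hrep : ∀ c, rep c ∈ principalLevelSubgroup δ 1)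
    (piece : ↥(finAdelic (↥(maximalRealSubfield L)) L (IsCMField.complexConj L) n H) → ι)
    (Z : ↥(finAdelic (↥(maximalRealSubfield L)) L (IsCMField.complexConj L) n H) → (Fin n → ℂ) → Matrix (Fin g) (Fin g) ℂ)
    (q : ↥(finAdelic (↥(maximalRealSubfield L)) L (IsCMField.complexConj L) n H) → ↥(gspRational δ))
    (hZ : ∀ a (v : Fin n → ℂ), v ∈ negCone (H.map τ) → Z a v ∈ siegelUpperHalfSpace g)
    (hq : ∀ (v : Fin n → ℂ), v ∈ negCone (H.map τ) → ∀ a,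
      conjJ (((gspRationalToReal δ (q a))⁻¹ : ↥(gspReal δ)) : GL (Fin g ⊕ Fin g) ℝ) (auxComplexStructureV F τ Φ v) = jOfSiegel δ (Z a v) ∧
        gspRationalToFinAdelic δ (q a) • ((rep (piece a) : ↥(gspFinAdelic δ)) : ↥(gspFinAdelic δ) ⧸ principalLevelSubgroup δ N) =
          ((auxToGspFinV F (a, 1) : ↥(gspFinAdelic δ)) : ↥(gspFinAdelic δ) ⧸ principalLevelSubgroup δ N)) :
    ∃ Mρ : ↥(finAdelic (↥(maximalRealSubfield L)) L (IsCMField.complexConj L) n H) → (𝓞 M →+* Matrix (Fin g ⊕ Fin g) (Fin g ⊕ Fin g) ℤ),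
      (∀ a (b b' : 𝓞 M), ((b' : 𝓞 M) : M) = IsCMField.complexConj M ((b : 𝓞 M) : M) → (Mρ a b')ᵀ * typeForm δ = typeForm δ * Mρ a b) ∧
      (∀ (v : Fin n → ℂ), v ∈ negCone (H.map τ) → ∀ a (b : 𝓞 M) (t : (ℝ ⊗[ℚ] M)ˣ), (t : ℝ ⊗[ℚ] M) = (1 : ℝ) ⊗ₜ[ℚ] ((b : 𝓞 M) : M) →
        (Mρ a b).map (Int.cast : ℤ → ℝ) =
          conjJ (((gspRationalToReal δ (q a))⁻¹ : ↥(gspReal δ)) : GL (Fin g ⊕ Fin g) ℝ)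
            ((auxRepV ℝ F (t, 1) : GL (Fin g ⊕ Fin g) ℝ) : Matrix (Fin g ⊕ Fin g) (Fin g ⊕ Fin g) ℝ)) ∧
      (∀ (v : Fin n → ℂ), v ∈ negCone (H.map τ) → ∀ a,
        periodZV M F Φ τ (((gspRationalToReal δ (q a))⁻¹ : ↥(gspReal δ)) : GL (Fin g ⊕ Fin g) ℝ) v = Z a v) ∧
      (∀ (v : Fin n → ℂ), v ∈ negCone (H.map τ) → ∀ a (b : 𝓞 M), ((b : 𝓞 M) : M) ≠ 0 →
        ∃ Cb : (Fin g → ℂ) →ₗ[ℂ] (Fin g → ℂ),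
          (∀ u : Fin g ⊕ Fin g → ℝ,
              Cb (siegelPeriodMap δ (Z a v) u) = siegelPeriodMap δ (Z a v) (((Mρ a b).map (Int.cast : ℤ → ℝ)) *ᵥ u)) ∧
            Cb.charpoly = ∏ ρ' : Φ.1, if ρ'.1.comp j = τ then
              (Polynomial.X - Polynomial.C (ComplexEmbedding.conjugate ρ'.1 ((b : 𝓞 M) : M))) *
                (Polynomial.X - Polynomial.C (ρ'.1 ((b : 𝓞 M) : M))) ^ (n - 1)
              else (Polynomial.X - Polynomial.C (ρ'.1 ((b : 𝓞 M) : M))) ^ n) ∧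
      (∀ (v : Fin n → ℂ), v ∈ negCone (H.map τ) → ∀ a (b : 𝓞 M),
        (Mρ a b).map (Int.cast : ℤ → ℚ) =
          ((((q a)⁻¹ : ↥(gspRational δ)) : GL (Fin g ⊕ Fin g) ℚ) : Matrix (Fin g ⊕ Fin g) (Fin g ⊕ Fin g) ℚ) * (ρ b).map (Int.cast : ℤ → ℚ) *
            (((q a : ↥(gspRational δ)) : GL (Fin g ⊕ Fin g) ℚ) : Matrix (Fin g ⊕ Fin g) (Fin g ⊕ Fin g) ℚ)) := by
  -- (Z) is independent of the construction
  have hZeq : ∀ (v : Fin n → ℂ), v ∈ negCone (H.map τ) → ∀ a,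
      periodZV M F Φ τ (((gspRationalToReal δ (q a))⁻¹ : ↥(gspReal δ)) : GL (Fin g ⊕ Fin g) ℝ) v = Z a v := by
    intro v hv a
    rw [periodZV, (hq v hv a).1, siegelOfJ_jOfSiegel hδ (hZ a v hv)]
  -- (K) from (N) and (Z), for any reading (the ED. 2 argument)
  have hK : ∀ Mρ : ↥(finAdelic (↥(maximalRealSubfield L)) L (IsCMField.complexConj L) n H) →
      (𝓞 M →+* Matrix (Fin g ⊕ Fin g) (Fin g ⊕ Fin g) ℤ),
      (∀ (v : Fin n → ℂ), v ∈ negCone (H.map τ) → ∀ a (b : 𝓞 M) (t : (ℝ ⊗[ℚ] M)ˣ), (t : ℝ ⊗[ℚ] M) = (1 : ℝ) ⊗ₜ[ℚ] ((b : 𝓞 M) : M) →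
        (Mρ a b).map (Int.cast : ℤ → ℝ) =
          conjJ (((gspRationalToReal δ (q a))⁻¹ : ↥(gspReal δ)) : GL (Fin g ⊕ Fin g) ℝ)
            ((auxRepV ℝ F (t, 1) : GL (Fin g ⊕ Fin g) ℝ) : Matrix (Fin g ⊕ Fin g) (Fin g ⊕ Fin g) ℝ)) →
      ∀ (v : Fin n → ℂ), v ∈ negCone (H.map τ) → ∀ a (b : 𝓞 M), ((b : 𝓞 M) : M) ≠ 0 →
        ∃ Cb : (Fin g → ℂ) →ₗ[ℂ] (Fin g → ℂ),
          (∀ u : Fin g ⊕ Fin g → ℝ,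
              Cb (siegelPeriodMap δ (Z a v) u) = siegelPeriodMap δ (Z a v) (((Mρ a b).map (Int.cast : ℤ → ℝ)) *ᵥ u)) ∧
            Cb.charpoly = ∏ ρ' : Φ.1, if ρ'.1.comp j = τ then
              (Polynomial.X - Polynomial.C (ComplexEmbedding.conjugate ρ'.1 ((b : 𝓞 M) : M))) *
                (Polynomial.X - Polynomial.C (ρ'.1 ((b : 𝓞 M) : M))) ^ (n - 1)
              else (Polynomial.X - Polynomial.C (ρ'.1 ((b : 𝓞 M) : M))) ^ n := by
    intro Mρ hN v hv a b hb
    set γ : GL (Fin g ⊕ Fin g) ℝ := (((gspRationalToReal δ (q a))⁻¹ : ↥(gspReal δ)) : GL (Fin g ⊕ Fin g) ℝ) with hγ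
    have hC0 : conjJ γ (auxComplexStructureV F τ Φ v) ∈ C0 δ := by
      rw [hγ, (hq v hv a).1]
      exact SiegelModuli.jOfSiegel_mem_C0 hδ (hZ a v hv)
    obtain ⟨t, ht⟩ := exists_tensorUnit_coe_eq_one_tmul M ℝ ((b : 𝓞 M) : M) hb
    obtain ⟨Cb, hCb, hchar⟩ := exists_lieAction_charpoly M F Φ τ hδ γ hv hC0 t ((b : 𝓞 M) : M) ht
    refine ⟨Cb, fun u => ?_, hchar⟩
    rw [← hZeq v hv a, hN v hv a b t ht, ← hγ]
    exact hCb u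
  -- the commutation of the reading with the adelic point `ũ_β(a, 1)`
  have hcomm : ∀ a (b : 𝓞 M),
      (ρ b).map (Int.cast : ℤ → finAdeleQ) *
          (((auxToGspFinV F (a, 1) : ↥(gspFinAdelic δ)) : GL (Fin g ⊕ Fin g) finAdeleQ) : Matrix (Fin g ⊕ Fin g) (Fin g ⊕ Fin g) finAdeleQ) =
        (((auxToGspFinV F (a, 1) : ↥(gspFinAdelic δ)) : GL (Fin g ⊕ Fin g) finAdeleQ) : Matrix (Fin g ⊕ Fin g) (Fin g ⊕ Fin g) finAdeleQ) *
          (ρ b).map (Int.cast : ℤ → finAdeleQ) := by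
    intro a b
    rw [coe_auxToGspFinV]
    exact map_intCast_reading_mul_coe_auxRepV_comm F ρ hρ finAdeleQ b _
  by_cases hne : (negCone (H.map τ)).Nonempty
  swap
  · -- empty cone: the unconjugated reading does it (only Rosati is asked)
    exact ⟨fun _ => ρ, fun a b b' hb' => reading_transpose_mul_typeForm F ρ hρ b b' hb', fun v hv => absurd ⟨v, hv⟩ hne,
      fun v hv => absurd ⟨v, hv⟩ hne, fun v hv => absurd ⟨v, hv⟩ hne, fun v hv => absurd ⟨v, hv⟩ hne⟩
  obtain ⟨v₀, hv₀⟩ := hne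
  -- the transported readings, one per `a`, WITH their frame relation
  have hex : ∀ a, ∃ ρ' : 𝓞 M →+* Matrix (Fin g ⊕ Fin g) (Fin g ⊕ Fin g) ℤ, ∀ b, (ρ' b).map (Int.cast : ℤ → ℚ) =
      ((((q a)⁻¹ : ↥(gspRational δ)) : GL (Fin g ⊕ Fin g) ℚ) : Matrix (Fin g ⊕ Fin g) (Fin g ⊕ Fin g) ℚ) * (ρ b).map (Int.cast : ℤ → ℚ) *
        (((q a : ↥(gspRational δ)) : GL (Fin g ⊕ Fin g) ℚ) : Matrix (Fin g ⊕ Fin g) (Fin g ⊕ Fin g) ℚ) := fun a =>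
    exists_ringHom_conj_of_smul_mk_eq ρ (q a) (auxToGspFinV F (a, 1)) (rep (piece a)) (principalLevelSubgroup δ N)
      (principalLevelSubgroup_anti δ (one_dvd N)) (hrep (piece a)) (hq v₀ hv₀ a).2 (hcomm a)
  choose Mρ hMρ using hex
  have hN : ∀ (v : Fin n → ℂ), v ∈ negCone (H.map τ) → ∀ a (b : 𝓞 M) (t : (ℝ ⊗[ℚ] M)ˣ),
      (t : ℝ ⊗[ℚ] M) = (1 : ℝ) ⊗ₜ[ℚ] ((b : 𝓞 M) : M) →
      (Mρ a b).map (Int.cast : ℤ → ℝ) =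
        conjJ (((gspRationalToReal δ (q a))⁻¹ : ↥(gspReal δ)) : GL (Fin g ⊕ Fin g) ℝ)
          ((auxRepV ℝ F (t, 1) : GL (Fin g ⊕ Fin g) ℝ) : Matrix (Fin g ⊕ Fin g) (Fin g ⊕ Fin g) ℝ) := fun v _ a b t ht => by
    rw [conj_reading_map_real ρ (Mρ a) (q a) (hMρ a) b, map_intCast_reading_eq_coe_auxRepV F ρ hρ ℝ b t ht, conjJ_def]
  exact ⟨Mρ, fun a b b' hb' =>
      conj_reading_transpose_mul_typeForm ρ (Mρ a) (q a) (hMρ a) b b' (reading_transpose_mul_typeForm F ρ hρ b b' hb'),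
    hN, hZeq, hK Mρ hN, fun v _ a b => hMρ a b⟩

end AuxV

end UnitaryCurve

end Literature.AlgebraicGeometry.ShimuraVarieties

end
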